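import Literature.Topology.FourManifolds.CircleBandCut
import Literature.Topology.FourManifolds.CombOfBasis
import Literature.Topology.FourManifolds.KnotWindingHypotheses
import HarnessLib

/-!
# The Seifert presentation of the Alexander module of a knot — assembly

Topic `Literature/Topology/FourManifolds`. The capstone of the covering-space road (Rolfsen (1976),
§7.A, §8.C; Lickorish (1997), Thm. 6.5): for a knot `K ⊂ S³`, a tubular neighbourhood `ν`, a
circle-valued map `f : S³ ∖ K → S¹` along which the meridian winds once, and a band about the
connected cut `{f = 1}` trivialised over the angle (`CircleBandData f`, a bicollared Seifert
surface), GIVEN a `ℤ`-basis `y` of `H₁({f ≠ 1}; ℤ)`, generators `c` of `H₁({f ≠ -1}; ℤ)` lifted to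
both sides and the integer matrices `A`, `B` of the two push-offs, the Alexander module
`G'/G''` of `G = π₁(S³ ∖ K)` is presented over `ℤ[Gᵃᵇ]` by the matrix `B − t A` (for the
linking-dual choice `B = V`, `A = Vᵀ`, the classical `V − tVᵀ`).

All the covering-space, Mayer–Vietoris and group-ring work is in the imported modules; this file
only assembles it (`Knot.TubularNbhd.exists_alexander_presentation_of_circleBandData`). What it does
NOT provide (the inputs left as hypotheses): the band itself (a bicollar of a Seifert surface), the
basis and matrices (Alexander duality / the Seifert form), and — for Fox–Milnor — a metabolizer.
Everything is proved; no named fact is introduced.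

## References

* D. Rolfsen, *Knots and Links*, Publish or Perish (1976), §7.A, §8.C. [Rolfsen1976]
* W. B. R. Lickorish, *An Introduction to Knot Theory*, GTM 175 (1997), Thm. 6.5. [Lickorish1997]
-/

noncomputable section

open Set Function
open scoped LaurentPolynomial Real
open Literature.AlgebraicTopology.SingularHomology
open Literature.Topology.FourManifolds.CircleMaps
open Literature.Topology.FourManifolds.CircleMaps.CyclicCover

namespace Literature.Topology.FourManifolds

namespace Knot.TubularNbhd

variable {K : Knot} (ν : Knot.TubularNbhd K)

set_option maxHeartbeats 1600000 in
/-- **The Seifert presentation of the Alexander module, assembled** (Rolfsen 1976, §8.C;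
Lickorish 1997, Thm. 6.5): see the module docstring. The isomorphism `e' : π₁ᵃᵇ ≃* ℤ` in the
conclusion is `[g] ↦ (f_* g)⁻¹` (`KnotWindingHypotheses`). [cite: Rolfsen1976, §8.C] -/
theorem exists_alexander_presentation_of_circleBandData (f : C(K.complement, Circle))
    (B : CircleBandData f) [PathConnectedSpace ↥{x : K.complement | f x = Circle.exp 0}]
    (h₀ : winding f ν.meridian = 1) {n m : ℕ}
    (b : Module.Basis (Fin n) ℤ (singularHomology ℤ ℤ ↥B.cutData.Y 1))
    (c : Fin m → singularHomology ℤ ℤ ↥B.cutData.N 1)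
    (hc : ∀ x : singularHomology ℤ ℤ ↥B.cutData.N 1, ∃ β : Fin m → ℤ, x = ∑ t, β t • c t)
    (bp : Fin m → singularHomology ℤ ℤ ↥B.cutData.plus 1)
    (bm : Fin m → singularHomology ℤ ℤ ↥B.cutData.minus 1)
    (hbp : ∀ t, B.cutData.jPlus ℤ ℤ 1 (bp t) = c t) (hbm : ∀ t, B.cutData.jMinus ℤ ℤ 1 (bm t) = c t)
    (A Bm : Matrix (Fin m) (Fin n) ℤ)
    (hA : ∀ t, B.cutData.iPlus ℤ ℤ 1 (bp t) = CutData.comb (⇑b) (A t))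
    (hB : ∀ t, B.cutData.iMinus ℤ ℤ 1 (bm t) = CutData.comb (⇑b) (Bm t)) :
    ∃ (e' : Abelianization (FundamentalGroup K.complement ν.basePoint) ≃* Multiplicative ℤ)
      (pres : (Fin n → MonoidAlgebra ℤ (Abelianization (FundamentalGroup K.complement ν.basePoint)))
        →ₗ[MonoidAlgebra ℤ (Abelianization (FundamentalGroup K.complement ν.basePoint))]
        alexanderModule (FundamentalGroup K.complement ν.basePoint)),
      (∀ g, e' (Abelianization.of g) = (windingHom f ν.basePoint g)⁻¹) ∧ Surjective pres ∧
      LinearMap.ker pres = Submodule.span _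
        (Set.range ((Bm.map (LaurentPolynomial.C : ℤ →+* ℤ[T;T⁻¹]) -
          (LaurentPolynomial.T 1 : ℤ[T;T⁻¹]) • A.map (LaurentPolynomial.C : ℤ →+* ℤ[T;T⁻¹])).map
            (laurentEquivOfMulEquiv (FundamentalGroup K.complement ν.basePoint) e').symm)) := by
  haveI : PathConnectedSpace K.complement := ν.pathConnectedSpace_complement
  obtain ⟨e', he'⟩ := ν.exists_mulEquiv_inv_windingHom h₀
  obtain ⟨pres, hsurj, hker⟩ := B.cutData.exists_presentation_laurent e' he' (⇑b) c bp bm A Bm h₀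
    (ν.ker_windingHom_eq_commutator h₀) (B.ε_plus_injective ℤ ℤ) (B.ε_minus_injective ℤ ℤ)
    (B.jPlus_bijective ℤ ℤ 1).2 (B.jPlus_bijective ℤ ℤ 1).1 (B.jMinus_bijective ℤ ℤ 1).1
    (B.cutData.exists_eq_comb_of_basis b) (B.cutData.eq_zero_of_comb_basis_eq_zero b) hc hbp hbm hA hB
  exact ⟨e', pres, he', hsurj, hker⟩

end Knot.TubularNbhd

end Literature.Topology.FourManifolds
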